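import Literature.AlgebraicGeometry.Resolution.FormalFibresRegularProofs
import Literature.AlgebraicGeometry.Resolution.QuasiRegularSequences
import Literature.AlgebraicGeometry.Resolution.RegularQuotientIdeal
import Literature.AlgebraicGeometry.Resolution.FormalRetractionSection
import HarnessLib

/-!
# A complete ring with a retraction onto `R/(w)`, `w` quasi-regular, is a power series ring
# over the retract (EGA 0_IV 19.5.4 pattern)

Topic: `Literature/AlgebraicGeometry/Resolution`, companion of `FormalFibresRegularProofs.lean`
(Cohen's structure theorem `A ≅ K⟦X₁,…,X_d⟧` for a complete regular local ring with a coefficient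
FIELD `K`, Matsumura Thm. 29.7). This file proves the RELATIVE form with a coefficient RING:

**Theorem** (`exists_ringEquiv_mvPowerSeries_of_retract`). Let `R` be a commutative ring,
`w = (w₁,…,w_d)` a QUASI-REGULAR family (Matsumura §16; e.g. a (weakly) regular sequence, Rees'
Thm. 16.2) generating the ideal `I = (w)`, and suppose `R` is `I`-adically complete and Hausdorff.
Let `π : R → S` be a ring homomorphism with kernel `I` admitting a ring SECTION `ι : S → R`,
`π ∘ ι = id` (a retraction of `Spec R` onto `V(I) ≅ Spec S`). Then the substitution
`S⟦W₁,…,W_d⟧ → R`, `W_i ↦ w_i`, coefficients through `ι`, is a ring ISOMORPHISM `e`; moreover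
`π ∘ e = (constant coefficient)` and `e(f) ∈ Iᴺ` iff `f` has no terms of total degree `< N`
(the isomorphism matches the `(W)`-adic and `I`-adic filtrations).

This is the mechanism of EGA 0_IV (19.5.4) b) ⇒ c) («`𝔍/𝔍²` projectif et `gr(B) = S(𝔍/𝔍²)` ⇒
`B̂ ≅ Ŝ_C(V)`», Publ. IHÉS 20 p. 90–92, there under a formal-smoothness hypothesis producing the
section; here the section is GIVEN) and of Matsumura's proof of Thm. 29.4/29.7 (successive
approximation + quasi-regularity), run with the residue-field section replaced by `ι`:

* surjectivity modulo `Iᴺ` (`Retract.exists_mvPolynomial_sub_eval_mem_pow`): an element of `Iᴺ` is a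
  form `F(w)` of degree `N`; `F − ι(π F)` has coefficients in `ker π = I`, so its value lies in
  `I^{N+1}`;
* quasi-regularity (`Retract.coeff_eq_zero_of_apply_map_mem_pow`): if `e(f) ∈ Iᴺ` then all
  coefficients of `f` of degree `< N` vanish — the lowest form `G = ι(f_ν)` of `f` would satisfy
  `G(w) ∈ I^{ν+1}`, so its coefficients `ι(c)` lie in `I = ker π`, forcing `c = π ι c = 0`;
* bijectivity by successive approximation and `⋂ Iᴺ = 0` (`Retract.comp_map_bijective`), verbatim
  the argument of `Resolution.comp_map_bijective`.

Corollaries: the `k`-ALGEBRA form when `π`, `ι` are `k`-algebra maps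
(`exists_algEquiv_mvPowerSeries_of_retract`); the Noetherian form for a weakly regular sequence
inside any ideal of definition (`…_of_isWeaklyRegular`); and the form met in the theory of formal
retractions (Hironaka 2005 [24], Def. 9.4 / Lemma 9.2 p.113–114, proof of Thm. 10.5 p.117 l.29–34:
«R̂ ≃ K[[w, y]] … Ŝ ≃ K[[y]] … ι_η : Ŝ → R̂ … n̂_η ∘ ι_η = id», and conversely a retraction makes the
complete regular local ring a power series ring over the retract):
`exists_ringEquiv_mvPowerSeries_of_retract_of_isRegularLocalRing` — a COMPLETE regular local ring
`R` with a regular quotient `R/J` and a ring section `ι` of `R → R/J` is `(R/J)⟦Y₁,…,Y_c⟧` with the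
`Y_i ↦` a quasi-regular generating family of `J` (`c = codim`), via the tree's
`exists_isQuasiRegular_span_eq_of_isRegularLocalRing_quotient` (Matsumura Thm. 14.2 + 16.2).
Everything here is PROVED; no definitions, no named facts.

## Sources

* A. Grothendieck, J. Dieudonné, EGA IV₁ (Publ. Math. IHÉS 20, 1964), Chap. 0 §19.5, Cor. (19.5.4)
  and its proof (19.5.4.2) (held: `paper:doi-10-1007-bf02684747`, PDF p. 90–92). [EGA0IV]
* H. Matsumura, *Commutative Ring Theory*, CUP 1986: §16 (quasi-regular sequences, Thm. 16.2),
  Thm. 29.4/29.7 (the successive-approximation proof pattern). [Matsumura1987]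
* H. Hironaka, *Three key theorems on infinitely near singularities*, Sémin. Congr. 10 (2005),
  Def. 9.2, Def. 9.4, Lemma 9.2 (pp.111–114), proof of Thm. 10.5 (p.117) — where the structure is
  USED (index only; nothing of that paper is asserted here). [Hironaka2005]
-/

noncomputable section

open IsLocalRing

namespace Literature.AlgebraicGeometry.Resolution

universe u v

/-! ## The expansion map along a retraction: quasi-regularity and successive approximation -/

namespace Retract

variable {R : Type u} [CommRing R] {S : Type u} [CommRing S] {d : ℕ} (w : Fin d → R)
  (π : R →+* S) (ι : S →+* R) (hι : ∀ s, π (ι s) = s)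
  (hker : RingHom.ker π = Ideal.span (Set.range w))
  (Φ : MvPowerSeries (Fin d) R →+* R)
  (hΦ₁ : ∀ P : MvPolynomial (Fin d) R, Φ (P : MvPowerSeries (Fin d) R) = MvPolynomial.eval w P)
  (hΦ₂ : ∀ (N : ℕ) (f : MvPowerSeries (Fin d) R),
    (∀ e : Fin d →₀ ℕ, e.degree < N → MvPowerSeries.coeff e f = 0) →
      Φ f ∈ Ideal.span (Set.range w) ^ N)

include hι hker in
/-- For a section `ι` of `π`, `c − ι(π c)` lies in `ker π = (w)` (plumbing). [folklore] -/
private theorem sub_section_mem (c : R) : c - ι (π c) ∈ Ideal.span (Set.range w) := by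
  rw [← hker, RingHom.mem_ker, map_sub, hι, sub_self]

include hι hker in
/-- For a section `ι` of `π`, `ι(s) ∈ (w) = ker π` only for `s = 0` (plumbing). [folklore] -/
private theorem eq_zero_of_section_mem {s : S} (hs : ι s ∈ Ideal.span (Set.range w)) :
    s = 0 := by
  rw [← hι s]
  rwa [← hker, RingHom.mem_ker] at hs

include hι hker hΦ₁ hΦ₂ in
/-- **Quasi-regularity of the expansion map along a retraction.** With `w` quasi-regular,
`I = (w) = ker π`, `ι` a section of `π` and `Φ : R⟦X⟧ → R` a substitution homomorphism
(`exists_adicEvalHom`): if `g ∈ S⟦X⟧` and `Φ(ιg) ∈ Iᴺ` then `g` has no terms of total degree `< N`.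
If `ν < N` is the least degree present in `g`, its degree-`ν` form `G = ι(g_ν) ∈ R[X]` has
`G(w) = Φ(ιg) − Φ(ιg − G) ∈ I^{ν+1}`, so by quasi-regularity its coefficients `ι(c_e)` lie in
`I = ker π`, forcing `c_e = π(ι c_e) = 0`. [cite: EGA0IV, 0_IV (19.5.4.2)] -/
theorem coeff_eq_zero_of_apply_map_mem_pow (hq : IsQuasiRegular w) {N : ℕ}
    {g : MvPowerSeries (Fin d) S}
    (hg : Φ (MvPowerSeries.map ι g) ∈ Ideal.span (Set.range w) ^ N) :
    ∀ e : Fin d →₀ ℕ, e.degree < N → MvPowerSeries.coeff e g = 0 := by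
  classical
  by_contra hcon
  push Not at hcon
  obtain ⟨e₀, he₀N, hge₀⟩ := hcon
  -- the least total degree `ν` carrying a nonzero coefficient; `ν < N`
  have hex : ∃ ν, ∃ e : Fin d →₀ ℕ, e.degree = ν ∧ MvPowerSeries.coeff e g ≠ 0 :=
    ⟨e₀.degree, e₀, rfl, hge₀⟩
  obtain ⟨e₁, he₁, hge₁⟩ := Nat.find_spec hex
  have hνN : Nat.find hex < N := lt_of_le_of_lt (Nat.find_min' hex ⟨e₀, rfl, hge₀⟩) he₀N
  have hmin : ∀ e : Fin d →₀ ℕ, e.degree < Nat.find hex → MvPowerSeries.coeff e g = 0 :=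
    fun e he => by
      by_contra h
      exact Nat.find_min hex he ⟨e, rfl, h⟩
  -- the degree-`ν` form `G = ι(g_ν) ∈ R[X]`
  set ν := Nat.find hex with hν
  set G : MvPolynomial (Fin d) R := ∑ e ∈ (Finset.univ : Finset (Fin d)).finsuppAntidiag ν,
    MvPolynomial.monomial e (ι (MvPowerSeries.coeff e g)) with hG
  have hGcoeff : ∀ e : Fin d →₀ ℕ, G.coeff e =
      if e.degree = ν then ι (MvPowerSeries.coeff e g) else 0 := fun e => by
    simp only [hG, MvPolynomial.coeff_sum, MvPolynomial.coeff_monomial, Finset.sum_ite_eq',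
      mem_finsuppAntidiag_univ_iff_degree]
  have hGhom : G.IsHomogeneous ν :=
    MvPolynomial.IsHomogeneous.sum _ _ _ fun e he =>
      MvPolynomial.isHomogeneous_monomial _ (mem_finsuppAntidiag_univ_iff_degree.mp he)
  -- `g' = ιg − G` has no terms of degree `≤ ν`, so `Φ g' ∈ I^{ν+1}`
  set g' : MvPowerSeries (Fin d) R := MvPowerSeries.map ι g - (G : MvPowerSeries (Fin d) R)
    with hg'
  have hg'coeff : ∀ e : Fin d →₀ ℕ, e.degree < ν + 1 → MvPowerSeries.coeff e g' = 0 := by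
    intro e he
    rw [hg', map_sub, MvPowerSeries.coeff_map, MvPolynomial.coeff_coe, hGcoeff]
    rcases (Nat.lt_succ_iff.mp he).lt_or_eq with hlt | heq
    · rw [if_neg hlt.ne, hmin e hlt, map_zero, sub_zero]
    · rw [if_pos heq, sub_self]
  have hg'val : Φ g' ∈ Ideal.span (Set.range w) ^ (ν + 1) := hΦ₂ _ _ hg'coeff
  -- hence `G(w) = Φ(ιg) − Φ g' ∈ I^{ν+1}`
  have hGval : MvPolynomial.eval w G ∈ Ideal.span (Set.range w) ^ (ν + 1) := by
    have hsplit : MvPolynomial.eval w G = Φ (MvPowerSeries.map ι g) - Φ g' := by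
      rw [← hΦ₁, hg', map_sub, sub_sub_cancel]
    rw [hsplit]
    exact Ideal.sub_mem _ (Ideal.pow_le_pow_right (Nat.succ_le_of_lt hνN) hg) hg'val
  -- quasi-regularity: the coefficients of `G` lie in `I`, so `c_{e₁} = 0`
  have hcoeff := (isQuasiRegular_def w).mp hq ν G hGhom hGval e₁
  rw [hGcoeff, if_pos he₁] at hcoeff
  exact hge₁ (eq_zero_of_section_mem w π ι hι hker hcoeff)

include hι hker in
/-- **Surjectivity modulo `Iᴺ`**: every `a ∈ R` is congruent modulo `Iᴺ = (w)ᴺ` to `(ιP)(w)` for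
some polynomial `P ∈ S[X]`. Induction on `N`: the error in `Iᴺ` is a form `F(w)` of degree `N`
(`exists_isHomogeneous_of_mem_span_pow`), and `F − ι(πF)` has coefficients in `ker π = I`, so its
value lies in `I·Iᴺ = I^{N+1}`. [cite: EGA0IV, 0_IV (19.5.4.2)] -/
theorem exists_mvPolynomial_sub_eval_mem_pow (N : ℕ) (a : R) :
    ∃ P : MvPolynomial (Fin d) S,
      a - MvPolynomial.eval w (MvPolynomial.map ι P) ∈ Ideal.span (Set.range w) ^ N := by
  induction N generalizing a with
  | zero => exact ⟨0, by rw [pow_zero, Ideal.one_eq_top]; exact Submodule.mem_top⟩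
  | succ N ih =>
    obtain ⟨P, hP⟩ := ih a
    obtain ⟨F, hF, hFx⟩ := exists_isHomogeneous_of_mem_span_pow w N hP
    -- `D = F − ι(π F)` is a form of degree `N` with coefficients in `I`
    have hDhom : (F - MvPolynomial.map (ι.comp π) F).IsHomogeneous N := hF.sub (hF.map _)
    have hDcoeff : F - MvPolynomial.map (ι.comp π) F ∈
        Ideal.map MvPolynomial.C (Ideal.span (Set.range w)) := by
      rw [MvPolynomial.mem_map_C_iff]
      intro e
      rw [MvPolynomial.coeff_sub, MvPolynomial.coeff_map, RingHom.comp_apply]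
      exact sub_section_mem w π ι hι hker _
    have hDval : MvPolynomial.eval w (F - MvPolynomial.map (ι.comp π) F) ∈
        Ideal.span (Set.range w) ^ (N + 1) := by
      have h := eval_mem_mul_span_pow w hDhom hDcoeff
      rwa [← pow_succ'] at h
    refine ⟨P + MvPolynomial.map π F, ?_⟩
    rw [map_add, map_add, MvPolynomial.map_map, ← sub_sub, ← hFx, ← map_sub]
    exact hDval

include hι hker hΦ₁ hΦ₂ in
/-- **The expansion map `Ψ = Φ ∘ ι : S⟦X₁,…,X_d⟧ → R` along a retraction is bijective** when
`R` is `(w)`-adically complete and Hausdorff and `w` is quasi-regular. Injective by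
`coeff_eq_zero_of_apply_map_mem_pow`; surjective by successive approximation: polynomials `P_N`
with `a ≡ (ιP_N)(w) mod Iᴺ` (`exists_mvPolynomial_sub_eval_mem_pow`) have coefficients stable
below degree `N` (same lemma), and the limiting series `g` satisfies `Ψ g − a ∈ ⋂ Iᴺ = 0`.
[cite: EGA0IV, 0_IV (19.5.4.2)] -/
theorem comp_map_bijective [IsHausdorff (Ideal.span (Set.range w)) R] (hq : IsQuasiRegular w) :
    Function.Bijective (Φ.comp (MvPowerSeries.map ι)) := by
  classical
  have hΨcoe : ∀ P : MvPolynomial (Fin d) S,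
      Φ.comp (MvPowerSeries.map ι) (P : MvPowerSeries (Fin d) S) =
        MvPolynomial.eval w (MvPolynomial.map ι P) := fun P => by
    rw [RingHom.comp_apply, ← coe_mvPolynomial_map, hΦ₁]
  refine ⟨?_, fun a => ?_⟩
  · -- injective
    rw [injective_iff_map_eq_zero]
    intro g hg
    ext e
    rw [MvPowerSeries.coeff_zero]
    refine coeff_eq_zero_of_apply_map_mem_pow w π ι hι hker Φ hΦ₁ hΦ₂ hq (N := e.degree + 1) ?_ e
      (Nat.lt_succ_self _)
    rw [← RingHom.comp_apply, hg]
    exact zero_mem _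
  · -- surjective: successive approximation
    choose P hP using fun N => exists_mvPolynomial_sub_eval_mem_pow w π ι hι hker N a
    -- the coefficients of degree `< N` of `P_N` and `P_{N+1}` agree
    have hstab : ∀ N (e : Fin d →₀ ℕ), e.degree < N →
        MvPolynomial.coeff e (P (N + 1)) = MvPolynomial.coeff e (P N) := by
      intro N e he
      have hdiff : Φ (MvPowerSeries.map ι
          ((P (N + 1) : MvPowerSeries (Fin d) S) - (P N : _))) ∈
            Ideal.span (Set.range w) ^ N := by
        rw [map_sub, map_sub, ← RingHom.comp_apply, ← RingHom.comp_apply, hΨcoe, hΨcoe]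
        convert Ideal.sub_mem _ (hP N) (Ideal.pow_le_pow_right N.le_succ (hP (N + 1))) using 1
        ring
      have h := coeff_eq_zero_of_apply_map_mem_pow w π ι hι hker Φ hΦ₁ hΦ₂ hq hdiff e he
      rwa [map_sub, MvPolynomial.coeff_coe, MvPolynomial.coeff_coe, sub_eq_zero] at h
    -- the limiting power series `g`, `g_e = (P_{|e|+1})_e`
    let g : MvPowerSeries (Fin d) S := fun e => MvPolynomial.coeff e (P (e.degree + 1))
    have hgcoeff : ∀ N (e : Fin d →₀ ℕ), e.degree < N →
        MvPowerSeries.coeff e g = MvPolynomial.coeff e (P N) := by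
      intro N
      induction N with
      | zero => intro e he; exact absurd he (Nat.not_lt_zero _)
      | succ N ih =>
        intro e he
        rcases (Nat.lt_succ_iff.mp he).lt_or_eq with hlt | heq
        · rw [ih e hlt, hstab N e hlt]
        · rw [MvPowerSeries.coeff_apply, ← heq]
    refine ⟨g, ?_⟩
    rw [← sub_eq_zero]
    refine eq_zero_of_forall_mem_pow (Ideal.span (Set.range w)) fun N => ?_
    have h1 : Φ.comp (MvPowerSeries.map ι)
        (g - (P N : MvPowerSeries (Fin d) S)) ∈ Ideal.span (Set.range w) ^ N := by
      rw [RingHom.comp_apply]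
      refine hΦ₂ N _ fun e he => ?_
      rw [MvPowerSeries.coeff_map, map_sub, MvPolynomial.coeff_coe, hgcoeff N e he, sub_self,
        map_zero]
    have h2 : Φ.comp (MvPowerSeries.map ι) (P N : MvPowerSeries (Fin d) S) - a ∈
        Ideal.span (Set.range w) ^ N := by
      rw [hΨcoe, ← Ideal.neg_mem_iff, neg_sub]
      exact hP N
    convert Ideal.add_mem _ h1 h2 using 1
    rw [map_sub]
    ring

include hΦ₁ in
/-- `Ψ(C s) = ι(s)`: the expansion map restricted to constants is the section (part of the
structure statement EGA 0_IV (19.5.4) c): the isomorphism is one of `C`-algebras).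
[cite: EGA0IV, 0_IV Cor. (19.5.4) c)] -/
theorem comp_map_C (s : S) : Φ.comp (MvPowerSeries.map ι) (MvPowerSeries.C s) = ι s := by
  rw [RingHom.comp_apply, MvPowerSeries.map_C, ← MvPolynomial.coe_C, hΦ₁, MvPolynomial.eval_C]

include hΦ₁ in
/-- `Ψ(X_i) = w_i`: the augmentation ideal goes to `𝔍 = (w)` generator by generator (part of the
structure statement EGA 0_IV (19.5.4) c)). [cite: EGA0IV, 0_IV Cor. (19.5.4) c)] -/
theorem comp_map_X (i : Fin d) : Φ.comp (MvPowerSeries.map ι) (MvPowerSeries.X i) = w i := by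
  rw [RingHom.comp_apply, MvPowerSeries.map_X, ← MvPolynomial.coe_X, hΦ₁, MvPolynomial.eval_X]

include hι hker hΦ₁ hΦ₂ in
/-- `π(Ψ f) = f(0)`: modulo `I = ker π` only the constant term survives (`Ψ(f − C f₀) ∈ I¹`) — the
isomorphism of EGA 0_IV (19.5.4) c) is compatible with the augmentations `B̂ → C`, `Ŝ_C(V) → C`.
[cite: EGA0IV, 0_IV Cor. (19.5.4) c)] -/
theorem apply_comp_map_eq_constantCoeff (f : MvPowerSeries (Fin d) S) :
    π (Φ.comp (MvPowerSeries.map ι) f) = MvPowerSeries.constantCoeff f := by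
  have h1 : Φ.comp (MvPowerSeries.map ι) (f - MvPowerSeries.C (MvPowerSeries.constantCoeff f)) ∈
      Ideal.span (Set.range w) ^ 1 := by
    rw [RingHom.comp_apply]
    refine hΦ₂ 1 _ fun e he => ?_
    have he0 : e = 0 := by
      rw [Nat.lt_one_iff, Finsupp.degree_eq_zero_iff] at he
      exact he
    subst he0
    rw [MvPowerSeries.coeff_map, map_sub, MvPowerSeries.coeff_C, if_pos rfl,
      MvPowerSeries.coeff_zero_eq_constantCoeff_apply, sub_self, map_zero]
  rw [pow_one, ← hker, RingHom.mem_ker, map_sub, comp_map_C w ι Φ hΦ₁, map_sub, hι,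
    sub_eq_zero] at h1
  exact h1

end Retract

/-! ## The structure theorem -/

section Main

variable {R : Type u} [CommRing R] {S : Type u} [CommRing S] {d : ℕ} (w : Fin d → R)

/-- **A complete ring with a retraction onto `R/(w)`, `w` quasi-regular, is a power series ring over
the retract.** Let `w = (w₁,…,w_d)` be a quasi-regular family in `R` with `R` complete and Hausdorff
for `I = (w)`, `π : R → S` a ring homomorphism with `ker π = I` and `ι : S → R` a ring homomorphism
with `π ∘ ι = id`. Then there is a ring isomorphism `e : S⟦W₁,…,W_d⟧ ≃ R` with `e(C s) = ι(s)`,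
`e(W_i) = w_i`, `π(e f) = f(0)`, and `e(f) ∈ Iᴺ ⟺ f` has no terms of total degree `< N`.
[cite: EGA0IV, 0_IV Cor. (19.5.4) b)⇒c) and (19.5.4.2)] -/
theorem exists_ringEquiv_mvPowerSeries_of_retract [IsAdicComplete (Ideal.span (Set.range w)) R]
    (hq : IsQuasiRegular w) (π : R →+* S) (ι : S →+* R) (hι : ∀ s, π (ι s) = s)
    (hker : RingHom.ker π = Ideal.span (Set.range w)) :
    ∃ e : MvPowerSeries (Fin d) S ≃+* R,
      (∀ s, e (MvPowerSeries.C s) = ι s) ∧ (∀ i, e (MvPowerSeries.X i) = w i) ∧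
      (∀ f, π (e f) = MvPowerSeries.constantCoeff f) ∧
      ∀ (N : ℕ) (f : MvPowerSeries (Fin d) S), e f ∈ Ideal.span (Set.range w) ^ N ↔
        ∀ m : Fin d →₀ ℕ, m.degree < N → MvPowerSeries.coeff m f = 0 := by
  have hwI : ∀ i, w i ∈ Ideal.span (Set.range w) := fun i => Ideal.subset_span ⟨i, rfl⟩
  obtain ⟨Φ, hΦ₁, hΦ₂⟩ := exists_adicEvalHom (Ideal.span (Set.range w)) w hwI
  have hbij := Retract.comp_map_bijective w π ι hι hker Φ hΦ₁ hΦ₂ hq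
  refine ⟨RingEquiv.ofBijective (Φ.comp (MvPowerSeries.map ι)) hbij,
    fun s => Retract.comp_map_C w ι Φ hΦ₁ s, fun i => Retract.comp_map_X w ι Φ hΦ₁ i,
    fun f => Retract.apply_comp_map_eq_constantCoeff w π ι hι hker Φ hΦ₁ hΦ₂ f,
    fun N f => ⟨fun h => ?_, fun h => ?_⟩⟩
  · exact Retract.coeff_eq_zero_of_apply_map_mem_pow w π ι hι hker Φ hΦ₁ hΦ₂ hq h
  · change Φ (MvPowerSeries.map ι f) ∈ _
    refine hΦ₂ N _ fun m hm => ?_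
    rw [MvPowerSeries.coeff_map, h m hm, map_zero]

/-- **`k`-algebra form.** If moreover `R`, `S` are `k`-algebras and `π`, `ι` are `k`-algebra maps,
the isomorphism `S⟦W⟧ ≃ R` is a `k`-algebra isomorphism (for the `k`-algebra structure of `S⟦W⟧`
through the constants). [cite: EGA0IV, 0_IV Cor. (19.5.4)] -/
theorem exists_algEquiv_mvPowerSeries_of_retract {k : Type v} [CommRing k] [Algebra k R]
    [Algebra k S] [IsAdicComplete (Ideal.span (Set.range w)) R] (hq : IsQuasiRegular w)
    (π : R →ₐ[k] S) (ι : S →ₐ[k] R) (hι : ∀ s, π (ι s) = s)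
    (hker : RingHom.ker (π : R →+* S) = Ideal.span (Set.range w)) :
    ∃ e : MvPowerSeries (Fin d) S ≃ₐ[k] R,
      (∀ s, e (MvPowerSeries.C s) = ι s) ∧ (∀ i, e (MvPowerSeries.X i) = w i) ∧
      (∀ f, π (e f) = MvPowerSeries.constantCoeff f) ∧
      ∀ (N : ℕ) (f : MvPowerSeries (Fin d) S), e f ∈ Ideal.span (Set.range w) ^ N ↔
        ∀ m : Fin d →₀ ℕ, m.degree < N → MvPowerSeries.coeff m f = 0 := by
  obtain ⟨e, heC, heX, heπ, heN⟩ := exists_ringEquiv_mvPowerSeries_of_retract w hq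
    (π : R →+* S) (ι : S →+* R) hι hker
  have hcomm : ∀ r : k, e (algebraMap k (MvPowerSeries (Fin d) S) r) = algebraMap k R r := by
    intro r
    rw [MvPowerSeries.algebraMap_apply, heC]
    exact ι.commutes r
  exact ⟨AlgEquiv.ofRingEquiv (f := e) hcomm, heC, heX, heπ, heN⟩

/-- **Noetherian form.** Let `R` be Noetherian and `J`-adically complete for some ideal `J`
(e.g. a complete local ring), `w` a WEAKLY REGULAR sequence of elements of `J`, `π : R → S` with
kernel `(w)` and a ring section `ι`. Then `S⟦W₁,…,W_d⟧ ≃ R` as above: `R` is `(w)`-adically complete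
(`IsAdicComplete.of_le_of_isNoetherianRing`) and `w` is quasi-regular by Rees' theorem
(`isQuasiRegular_of_isWeaklyRegular`). [cite: Matsumura1987, Thm. 16.2 (i) and Thm. 8.10–8.14] -/
theorem exists_ringEquiv_mvPowerSeries_of_retract_of_isWeaklyRegular [IsNoetherianRing R]
    (J : Ideal R) [IsAdicComplete J R] (hwJ : ∀ i, w i ∈ J)
    (hreg : RingTheory.Sequence.IsWeaklyRegular R (List.ofFn w))
    (π : R →+* S) (ι : S →+* R) (hι : ∀ s, π (ι s) = s)
    (hker : RingHom.ker π = Ideal.span (Set.range w)) :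
    ∃ e : MvPowerSeries (Fin d) S ≃+* R,
      (∀ s, e (MvPowerSeries.C s) = ι s) ∧ (∀ i, e (MvPowerSeries.X i) = w i) ∧
      (∀ f, π (e f) = MvPowerSeries.constantCoeff f) ∧
      ∀ (N : ℕ) (f : MvPowerSeries (Fin d) S), e f ∈ Ideal.span (Set.range w) ^ N ↔
        ∀ m : Fin d →₀ ℕ, m.degree < N → MvPowerSeries.coeff m f = 0 := by
  have hle : Ideal.span (Set.range w) ≤ J := Ideal.span_le.mpr (by rintro _ ⟨i, rfl⟩; exact hwJ i)
  haveI : IsAdicComplete (Ideal.span (Set.range w)) R :=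
    IsAdicComplete.of_le_of_isNoetherianRing J _ hle
  exact exists_ringEquiv_mvPowerSeries_of_retract w (isQuasiRegular_of_isWeaklyRegular w hreg)
    π ι hι hker

end Main

/-! ## Complete regular local rings with a retraction onto a regular quotient
(the situation of a formal retraction, Hironaka 2005 Def. 9.4 / proof of Thm. 10.5) -/

section RegularLocal

variable {R : Type u} [CommRing R] [IsRegularLocalRing R]

/-- **A complete regular local ring retracting onto a regular quotient is a power series ring over
it.** Let `R` be a regular local ring, complete (`𝔪`-adically), `J` an ideal with `R/J` a regular
local ring, and `ι : R/J → R` a ring SECTION of the quotient map (`mk ∘ ι = id`; a formal retraction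
of `Spec R` onto `Spec R/J` in the sense of Hironaka 2005 Def. 9.1/9.4). Then for a suitable
quasi-regular generating family `y = (y₁,…,y_c)` of `J` (part of a regular system of parameters;
Matsumura Thm. 14.2) the substitution `(R/J)⟦Y₁,…,Y_c⟧ → R`, `Y_i ↦ y_i`, coefficients through `ι`,
is a ring isomorphism compatible with the quotient map and the `J`-adic / `(Y)`-adic filtrations.
(Hironaka 2005 p.114 l.17–23 writes, for `R = K[[w, y]] ⊃ ι(Ŝ) = K[[y]]`, exactly this structure;
here it is derived from the retraction alone.) [cite: EGA0IV, 0_IV Cor. (19.5.4)] -/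
theorem exists_ringEquiv_mvPowerSeries_of_retract_of_isRegularLocalRing
    [IsAdicComplete (maximalIdeal R) R] {J : Ideal R} (hJ : J ≤ maximalIdeal R)
    [IsRegularLocalRing (R ⧸ J)] (ι : (R ⧸ J) →+* R) (hι : ∀ s, Ideal.Quotient.mk J (ι s) = s) :
    ∃ (c : ℕ) (y : Fin c → R), Ideal.span (Set.range y) = J ∧ IsQuasiRegular y ∧
      ∃ e : MvPowerSeries (Fin c) (R ⧸ J) ≃+* R,
        (∀ s, e (MvPowerSeries.C s) = ι s) ∧ (∀ i, e (MvPowerSeries.X i) = y i) ∧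
        (∀ f, Ideal.Quotient.mk J (e f) = MvPowerSeries.constantCoeff f) ∧
        ∀ (N : ℕ) (f : MvPowerSeries (Fin c) (R ⧸ J)), e f ∈ J ^ N ↔
          ∀ m : Fin c →₀ ℕ, m.degree < N → MvPowerSeries.coeff m f = 0 := by
  obtain ⟨c, y, -, hspan, hq, -⟩ :=
    exists_isQuasiRegular_span_eq_of_isRegularLocalRing_quotient hJ (J : Set R) (Ideal.span_eq J)
  have hle : Ideal.span (Set.range y) ≤ maximalIdeal R := hspan ▸ hJ
  haveI : IsAdicComplete (Ideal.span (Set.range y)) R :=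
    IsAdicComplete.of_le_of_isNoetherianRing (maximalIdeal R) _ hle
  have hker : RingHom.ker (Ideal.Quotient.mk J) = Ideal.span (Set.range y) := by
    rw [Ideal.mk_ker, hspan]
  obtain ⟨e, heC, heX, heπ, heN⟩ :=
    exists_ringEquiv_mvPowerSeries_of_retract y hq (Ideal.Quotient.mk J) ι hι hker
  refine ⟨c, y, hspan, hq, e, heC, heX, heπ, fun N f => ?_⟩
  have h := heN N f
  rw [hspan] at h
  exact h

/-- The same in `k`-ALGEBRA form, for a `k`-linear section (Hironaka 2005 Rem. 9.5: over a perfect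
field the formal retraction can be chosen `k`-linear). [cite: EGA0IV, 0_IV Cor. (19.5.4)] -/
theorem exists_algEquiv_mvPowerSeries_of_retract_of_isRegularLocalRing {k : Type v} [CommRing k]
    [Algebra k R] [IsAdicComplete (maximalIdeal R) R] {J : Ideal R} (hJ : J ≤ maximalIdeal R)
    [IsRegularLocalRing (R ⧸ J)] (ι : (R ⧸ J) →ₐ[k] R)
    (hι : ∀ s, Ideal.Quotient.mk J (ι s) = s) :
    ∃ (c : ℕ) (y : Fin c → R), Ideal.span (Set.range y) = J ∧ IsQuasiRegular y ∧
      ∃ e : MvPowerSeries (Fin c) (R ⧸ J) ≃ₐ[k] R,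
        (∀ s, e (MvPowerSeries.C s) = ι s) ∧ (∀ i, e (MvPowerSeries.X i) = y i) ∧
        (∀ f, Ideal.Quotient.mk J (e f) = MvPowerSeries.constantCoeff f) ∧
        ∀ (N : ℕ) (f : MvPowerSeries (Fin c) (R ⧸ J)), e f ∈ J ^ N ↔
          ∀ m : Fin c →₀ ℕ, m.degree < N → MvPowerSeries.coeff m f = 0 := by
  obtain ⟨c, y, -, hspan, hq, -⟩ :=
    exists_isQuasiRegular_span_eq_of_isRegularLocalRing_quotient hJ (J : Set R) (Ideal.span_eq J)
  have hle : Ideal.span (Set.range y) ≤ maximalIdeal R := hspan ▸ hJ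
  haveI : IsAdicComplete (Ideal.span (Set.range y)) R :=
    IsAdicComplete.of_le_of_isNoetherianRing (maximalIdeal R) _ hle
  have hker : RingHom.ker ((Ideal.Quotient.mkₐ k J : R →ₐ[k] R ⧸ J) : R →+* R ⧸ J) =
      Ideal.span (Set.range y) := by
    rw [Ideal.Quotient.mkₐ_ker, hspan]
  obtain ⟨e, heC, heX, heπ, heN⟩ :=
    exists_algEquiv_mvPowerSeries_of_retract y hq (Ideal.Quotient.mkₐ k J) ι hι hker
  refine ⟨c, y, hspan, hq, e, heC, heX, heπ, fun N f => ?_⟩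
  have h := heN N f
  rw [hspan] at h
  exact h

end RegularLocal

end Literature.AlgebraicGeometry.Resolution

end
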